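import Summits.Ventures.PercRepro.RankLevelSetRuleQSliceDensityGeneral
import Summits.Ventures.PercRepro.RankLevelSetRuleQCellOne

/-!
# PercRepro — THE FIRST UNTRUNCATED SLICE `u = k − 1` ON THE BOTTOM REGIME, EVERY FAMILY (night-1, gen 21; dossier §32.2)

The borderline pattern (gens 20–21) repeats one slice up. With `k = L + 1`, `u = L`, `q = m + L`, the tail
`T'(m) = sliceTail L (L+1) m = Σ_{L+1 ≤ j ≤ 2L+1} C(2L+1, j)·S_j(q, m)` decreases in `m` while `m + L + 1 ≤ (L+1)(L+2)`
(`sliceTail_succ_le_self`), the density comparison holds for `m ≤ L(L+1)` (`rho_density_ge_slice`), and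
* **`sliceTail_first_three_le (L) : sliceTail L (L+1) 3 ≤ 9/10`** for EVERY `L` — the terms `firstTerm L i`
  (`i = j − L − 1`) contract by `r(L) = L(L+5)/((L+2)(2L+8)) < 1/2` (`firstTerm_succ_le`, termwise in `a`), and
  `firstTerm L 0 ≤ (L+3)(27L+95)/(16(2L+3)(2L+7))` (`firstTerm_zero_le`); the geometric sum closes with
  `144(2L+3)(2L+7)(L²+7L+16) − 10(L+3)(27L+95)(L+2)(2L+8) = 36L⁴ + 152L³ + 1260L² + 4888L + 2784 ≥ 0`
  (exact values: `T'(3, k) = 0.72 … 0.80`, the chain `≤ 0.864`);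
* **`first_untrunc_bottom (L m) (3 ≤ m) (m ≤ L(L+1)) : Φ(q+k, q) ≤ R̂(q, k, m)`** — every cell of the slice `u = k − 1` with
  `3 ≤ m ≤ (k−1)k`, every family `k ≥ 1`;
* **`first_untrunc_slice (k q) (1 ≤ k) (k + 2 ≤ q) (q + 1 ≤ k²) : Φ(q+k, q) ≤ R̂(q, k, q − (k−1))`** and
  **`first_untrunc_slice_all`** (adding `q = k − 1`, `q = k` by `rhat_zero_eq`, `rhatCell_one`): the slice `u = k − 1` is paid on
  every cell `k − 1 ≤ q ≤ k² − 1` except possibly `q = k + 1` (`m = 2`; p4's whole-cell theorems cover it for `k ≤ 29`).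
Twin: mining/night-1/g21/firstuntr.py, firstuntr2.py (exact: `T'(3, k)`, the chain, all `k < 80`). Axioms: standard.
-/

namespace PercRepro

open Finset

/-- The `i`-th term of `T'(3) = sliceTail L (L+1) 3` (`j = L + 1 + i`):
`C(2L+1, L+1+i) · Σ_{a ≤ 3} C(3, a)/C(3+L+(L+1+i)+a, a+(L+1+i))`. -/
def firstTerm (L i : ℕ) : ℚ :=
  ((2 * L + 1).choose (L + 1 + i) : ℚ)
    * ∑ a ∈ range (3 + 1), ((3 : ℕ).choose a : ℚ) / ((3 + L + (L + 1 + i) + a).choose (a + (L + 1 + i)) : ℚ)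

/-- `sliceTail L (L+1) 3 = Σ_{i ≤ L} firstTerm L i`. -/
lemma sliceTail_first_eq (L : ℕ) : sliceTail L (L + 1) 3 = ∑ i ∈ range (L + 1), firstTerm L i := by
  unfold sliceTail firstTerm
  have h : Finset.Icc (L + 1) (L + (L + 1)) = Finset.Ico (L + 1) (2 * L + 1 + 1) := by
    ext j; simp only [Finset.mem_Icc, Finset.mem_Ico]; omega
  rw [h, Finset.sum_Ico_eq_sum_range, show 2 * L + 1 + 1 - (L + 1) = L + 1 by omega, show L + (L + 1) = 2 * L + 1 by ring]

/-- The terms are nonnegative. -/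
lemma firstTerm_nonneg (L i : ℕ) : 0 ≤ firstTerm L i := by
  unfold firstTerm
  apply mul_nonneg (by positivity)
  apply Finset.sum_nonneg
  intro a _
  positivity

/-- The contraction ratio `r(L) = L(L+5)/((L+2)(2L+8))`. -/
def firstRatio (L : ℕ) : ℚ := ((L : ℚ) * ((L : ℚ) + 5)) / (((L : ℚ) + 2) * (2 * (L : ℚ) + 8))

/-- `r(L) ≥ 0`. -/
lemma firstRatio_nonneg (L : ℕ) : 0 ≤ firstRatio L := by unfold firstRatio; positivity

/-- `r(L) < 1/2`. -/
lemma firstRatio_lt_half (L : ℕ) : firstRatio L < 1 / 2 := by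
  unfold firstRatio
  rw [div_lt_iff₀ (by positivity)]
  have : (0 : ℚ) ≤ L := by positivity
  nlinarith

/-- **The terms of `T'(3)` contract**: `firstTerm L (i+1) ≤ r(L) · firstTerm L i` for `i + 1 ≤ L` — termwise in `a`:
`C(2L+1, L+2+i) = C(2L+1, L+1+i)·(L−i)/(L+2+i)`, `1/C(N+1, r+1) = (r+1)/(N+1)·1/C(N, r)`, the `a`-factor
`(L+2+i+a)/(2L+5+i+a) ≤ (L+5+i)/(2L+8+i)` (`a ≤ 3`), and `(L−i)(L+5+i)/((L+2+i)(2L+8+i)) ≤ r(L)`. -/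
lemma firstTerm_succ_le (L i : ℕ) (hi : i + 1 ≤ L) : firstTerm L (i + 1) ≤ firstRatio L * firstTerm L i := by
  unfold firstTerm
  rw [Finset.mul_sum, Finset.mul_sum, Finset.mul_sum]
  apply Finset.sum_le_sum
  intro a ha
  rw [Finset.mem_range] at ha
  rw [show L + 1 + (i + 1) = L + 1 + i + 1 by ring,
    show 3 + L + (L + 1 + i + 1) + a = 3 + L + (L + 1 + i) + a + 1 by ring,
    show a + (L + 1 + i + 1) = a + (L + 1 + i) + 1 by ring]
  have h1 := Nat.choose_succ_right_eq (2 * L + 1) (L + 1 + i)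
  rw [show 2 * L + 1 - (L + 1 + i) = L - i by omega] at h1
  have hc1 := congrArg (fun x : ℕ => (x : ℚ)) h1
  push_cast [Nat.cast_sub (by omega : i ≤ L)] at hc1
  have h2 := Nat.add_one_mul_choose_eq (3 + L + (L + 1 + i) + a) (a + (L + 1 + i))
  have hc2 := congrArg (fun x : ℕ => (x : ℚ)) h2
  push_cast at hc2
  have hT : (0 : ℚ) < ((2 * L + 1).choose (L + 1 + i) : ℚ) := Nat.cast_pos.mpr (Nat.choose_pos (by omega))
  have hB : (0 : ℚ) < ((3 + L + (L + 1 + i) + a).choose (a + (L + 1 + i)) : ℚ) :=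
    Nat.cast_pos.mpr (Nat.choose_pos (by omega))
  have hB' : (0 : ℚ) < ((3 + L + (L + 1 + i) + a + 1).choose (a + (L + 1 + i) + 1) : ℚ) :=
    Nat.cast_pos.mpr (Nat.choose_pos (by omega))
  have hiL : (i : ℚ) + 1 ≤ L := by exact_mod_cast hi
  have ha3 : (a : ℚ) ≤ 3 := by exact_mod_cast (by omega : a ≤ 3)
  have ha0 : (0 : ℚ) ≤ a := by positivity
  have hi0 : (0 : ℚ) ≤ i := by positivity
  have hL0 : (0 : ℚ) ≤ L := by positivity
  have hpos1 : (0 : ℚ) < (L : ℚ) + 1 + i + 1 := by positivity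
  have hpos2 : (0 : ℚ) < ((3 + L + (L + 1 + i) + a : ℕ) : ℚ) + 1 := by positivity
  have e1 : ((2 * L + 1).choose (L + 1 + i + 1) : ℚ)
      = ((2 * L + 1).choose (L + 1 + i) : ℚ) * (((L : ℚ) - i) / ((L : ℚ) + 1 + i + 1)) := by
    rw [mul_div_assoc', eq_div_iff hpos1.ne']; linarith [hc1]
  have e2 : (1 : ℚ) / ((3 + L + (L + 1 + i) + a + 1).choose (a + (L + 1 + i) + 1) : ℚ)
      = ((((a + (L + 1 + i) : ℕ) : ℚ) + 1) / (((3 + L + (L + 1 + i) + a : ℕ) : ℚ) + 1))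
          * (1 / ((3 + L + (L + 1 + i) + a).choose (a + (L + 1 + i)) : ℚ)) := by
    rw [div_mul_div_comm, mul_one, div_eq_div_iff hB'.ne' (by positivity)]
    push_cast
    linarith [hc2]
  -- the ratio bound: (L−i)/(L+2+i) · (a+L+2+i)/(2L+5+i+a) ≤ r(L)
  have hr : (((L : ℚ) - i) / ((L : ℚ) + 1 + i + 1))
      * ((((a + (L + 1 + i) : ℕ) : ℚ) + 1) / (((3 + L + (L + 1 + i) + a : ℕ) : ℚ) + 1)) ≤ firstRatio L := by
    push_cast
    -- step 1: the a-factor is at most (L+5+i)/(2L+8+i)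
    have hA : ((a : ℚ) + (L + 1 + i) + 1) / (3 + (L : ℚ) + (L + 1 + i) + a + 1) ≤ ((L : ℚ) + 5 + i) / (2 * L + 8 + i) := by
      rw [div_le_div_iff₀ (by positivity) (by positivity)]
      nlinarith [mul_nonneg (by linarith : (0 : ℚ) ≤ 3 - a) (by positivity : (0 : ℚ) ≤ (L : ℚ) + 3)]
    -- step 2: (L−i)(L+5+i)/((L+2+i)(2L+8+i)) ≤ L(L+5)/((L+2)(2L+8))
    have hP : (((L : ℚ) - i) / ((L : ℚ) + 1 + i + 1)) * (((L : ℚ) + 5 + i) / (2 * L + 8 + i)) ≤ firstRatio L := by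
      unfold firstRatio
      rw [div_mul_div_comm, div_le_div_iff₀ (by positivity) (by positivity)]
      have key : (L : ℚ) * (L + 5) * ((L + 1 + i + 1) * (2 * L + 8 + i)) - ((L : ℚ) - i) * (L + 5 + i) * ((L + 2) * (2 * L + 8))
          = (L : ℚ) * (L + 5) * (i * (3 * L + 10) + i ^ 2) + (5 * i + i ^ 2) * (L + 2) * (2 * L + 8) := by ring
      have : (0 : ℚ) ≤ (L : ℚ) * (L + 5) * (i * (3 * L + 10) + i ^ 2) + (5 * i + i ^ 2) * (L + 2) * (2 * L + 8) := by
        positivity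
      linarith
    have hLi : (0 : ℚ) ≤ ((L : ℚ) - i) / ((L : ℚ) + 1 + i + 1) := by
      apply div_nonneg _ (by positivity); linarith
    calc (((L : ℚ) - i) / ((L : ℚ) + 1 + i + 1)) * (((a : ℚ) + (L + 1 + i) + 1) / (3 + (L : ℚ) + (L + 1 + i) + a + 1))
        ≤ (((L : ℚ) - i) / ((L : ℚ) + 1 + i + 1)) * (((L : ℚ) + 5 + i) / (2 * L + 8 + i)) :=
          mul_le_mul_of_nonneg_left hA hLi
      _ ≤ firstRatio L := hP
  rw [div_eq_mul_one_div (((3 : ℕ).choose a : ℚ)), div_eq_mul_one_div (((3 : ℕ).choose a : ℚ)), e1, e2]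
  calc ((2 * L + 1).choose (L + 1 + i) : ℚ) * (((L : ℚ) - i) / ((L : ℚ) + 1 + i + 1))
        * (((3 : ℕ).choose a : ℚ) * (((((a + (L + 1 + i) : ℕ) : ℚ) + 1) / (((3 + L + (L + 1 + i) + a : ℕ) : ℚ) + 1))
          * (1 / ((3 + L + (L + 1 + i) + a).choose (a + (L + 1 + i)) : ℚ))))
      = (((2 * L + 1).choose (L + 1 + i) : ℚ) * (((3 : ℕ).choose a : ℚ)
          * (1 / ((3 + L + (L + 1 + i) + a).choose (a + (L + 1 + i)) : ℚ))))
        * ((((L : ℚ) - i) / ((L : ℚ) + 1 + i + 1))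
          * ((((a + (L + 1 + i) : ℕ) : ℚ) + 1) / (((3 + L + (L + 1 + i) + a : ℕ) : ℚ) + 1))) := by ring
    _ ≤ (((2 * L + 1).choose (L + 1 + i) : ℚ) * (((3 : ℕ).choose a : ℚ)
          * (1 / ((3 + L + (L + 1 + i) + a).choose (a + (L + 1 + i)) : ℚ)))) * firstRatio L :=
        mul_le_mul_of_nonneg_left hr (by positivity)
    _ = _ := by ring

/-- `firstTerm L i ≤ firstTerm L 0 · r(L)^i` for `i ≤ L`. -/
lemma firstTerm_le_geom (L : ℕ) : ∀ i : ℕ, i ≤ L → firstTerm L i ≤ firstTerm L 0 * firstRatio L ^ i := by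
  intro i
  induction i with
  | zero => intro _; simp
  | succ i ih =>
    intro hi
    calc firstTerm L (i + 1) ≤ firstRatio L * firstTerm L i := firstTerm_succ_le L i hi
      _ ≤ firstRatio L * (firstTerm L 0 * firstRatio L ^ i) :=
          mul_le_mul_of_nonneg_left (ih (by omega)) (firstRatio_nonneg L)
      _ = firstTerm L 0 * firstRatio L ^ (i + 1) := by ring

/-- `Σ_{i<n} r^i ≤ 1/(1 − r)` for `0 ≤ r < 1`. -/
lemma sum_geom_le_inv (r : ℚ) (h0 : 0 ≤ r) (h1 : r < 1) (n : ℕ) : ∑ i ∈ range n, r ^ i ≤ 1 / (1 - r) := by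
  rw [geom_sum_eq (by linarith : r ≠ 1)]
  have hr : 0 < 1 - r := by linarith
  have e : (r ^ n - 1) / (r - 1) = (1 - r ^ n) / (1 - r) := by
    rw [← neg_sub 1 (r ^ n), ← neg_sub 1 r, neg_div_neg_eq]
  rw [e, div_le_div_iff₀ hr hr]
  have : 0 ≤ r ^ n := by positivity
  nlinarith

/-- **The first term of `T'(3)`**: `firstTerm L 0 ≤ (L+3)(27L+95)/(16(2L+3)(2L+7))` —
`C(2L+1, L+1)/C(2L+4, L+1) = (L+3)/(4(2L+3))`, `C(2L+5, L+2) = ((2L+5)/(L+2))·C(2L+4, L+1) ≥ 2·C(2L+4, L+1)`,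
`C(2L+6, L+3) = 2·C(2L+5, L+2)`, `C(2L+7, L+4) = ((2L+7)/(L+4))·C(2L+6, L+3)`, so the bracket is at most
`1 + 3/2 + 3/4 + (L+4)/(4(2L+7))`. -/
lemma firstTerm_zero_le (L : ℕ) :
    firstTerm L 0 ≤ (((L : ℚ) + 3) * (27 * (L : ℚ) + 95)) / (16 * (2 * (L : ℚ) + 3) * (2 * (L : ℚ) + 7)) := by
  unfold firstTerm
  have c32 : (3 : ℕ).choose 2 = 3 := by decide
  simp only [Finset.sum_range_succ, Finset.sum_range_zero, Nat.add_zero, zero_add]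
  rw [show 3 + L + (L + 1) = 2 * L + 4 by ring, show 2 * L + 4 + 1 = 2 * L + 5 by ring,
    show 2 * L + 4 + 2 = 2 * L + 6 by ring, show 2 * L + 4 + 3 = 2 * L + 7 by ring,
    show 1 + (L + 1) = L + 2 by ring, show 2 + (L + 1) = L + 3 by ring, show 3 + (L + 1) = L + 4 by ring]
  simp only [Nat.choose_zero_right, Nat.choose_one_right, Nat.choose_self, c32, Nat.cast_one, Nat.cast_ofNat]
  -- the ratio C(2L+1, L+1)/C(2L+4, L+1)
  have r1 := Nat.choose_mul_succ_eq (2 * L + 1) (L + 1)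
  have r2 := Nat.choose_mul_succ_eq (2 * L + 2) (L + 1)
  have r3 := Nat.choose_mul_succ_eq (2 * L + 3) (L + 1)
  rw [show 2 * L + 1 + 1 - (L + 1) = L + 1 by omega, show 2 * L + 1 + 1 = 2 * L + 2 by ring] at r1
  rw [show 2 * L + 2 + 1 - (L + 1) = L + 2 by omega, show 2 * L + 2 + 1 = 2 * L + 3 by ring] at r2
  rw [show 2 * L + 3 + 1 - (L + 1) = L + 3 by omega, show 2 * L + 3 + 1 = 2 * L + 4 by ring] at r3
  have s1 := Nat.add_one_mul_choose_eq (2 * L + 4) (L + 1)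
  have s2 := Nat.add_one_mul_choose_eq (2 * L + 5) (L + 2)
  have s3 := Nat.add_one_mul_choose_eq (2 * L + 6) (L + 3)
  rw [show 2 * L + 4 + 1 = 2 * L + 5 by ring, show L + 1 + 1 = L + 2 by ring] at s1
  rw [show 2 * L + 5 + 1 = 2 * L + 6 by ring, show L + 2 + 1 = L + 3 by ring] at s2
  rw [show 2 * L + 6 + 1 = 2 * L + 7 by ring, show L + 3 + 1 = L + 4 by ring] at s3
  have c1 := congrArg (fun x : ℕ => (x : ℚ)) r1
  have c2 := congrArg (fun x : ℕ => (x : ℚ)) r2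
  have c3 := congrArg (fun x : ℕ => (x : ℚ)) r3
  have d1 := congrArg (fun x : ℕ => (x : ℚ)) s1
  have d2 := congrArg (fun x : ℕ => (x : ℚ)) s2
  have d3 := congrArg (fun x : ℕ => (x : ℚ)) s3
  push_cast at c1 c2 c3 d1 d2 d3
  clear r1 r2 r3 s1 s2 s3
  have hA : (0 : ℚ) < ((2 * L + 1).choose (L + 1) : ℚ) := Nat.cast_pos.mpr (Nat.choose_pos (by omega))
  have hB0 : (0 : ℚ) < ((2 * L + 4).choose (L + 1) : ℚ) := Nat.cast_pos.mpr (Nat.choose_pos (by omega))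
  have hB1 : (0 : ℚ) < ((2 * L + 5).choose (L + 2) : ℚ) := Nat.cast_pos.mpr (Nat.choose_pos (by omega))
  have hB2 : (0 : ℚ) < ((2 * L + 6).choose (L + 3) : ℚ) := Nat.cast_pos.mpr (Nat.choose_pos (by omega))
  have hB3 : (0 : ℚ) < ((2 * L + 7).choose (L + 4) : ℚ) := Nat.cast_pos.mpr (Nat.choose_pos (by omega))
  have hL : (0 : ℚ) ≤ L := by positivity
  have hL2 : (0 : ℚ) < (L : ℚ) + 2 := by positivity
  have hL3 : (0 : ℚ) < (L : ℚ) + 3 := by positivity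
  have hL4 : (0 : ℚ) < (L : ℚ) + 4 := by positivity
  set A : ℚ := ((2 * L + 1).choose (L + 1) : ℚ) with hAdef
  set B₀ : ℚ := ((2 * L + 4).choose (L + 1) : ℚ) with hB0def
  set B₁ : ℚ := ((2 * L + 5).choose (L + 2) : ℚ) with hB1def
  set B₂ : ℚ := ((2 * L + 6).choose (L + 3) : ℚ) with hB2def
  set B₃ : ℚ := ((2 * L + 7).choose (L + 4) : ℚ) with hB3def
  -- A · 4(2L+3) = B₀ · (L+3)
  have iA : A * (4 * (2 * (L : ℚ) + 3)) = B₀ * ((L : ℚ) + 3) := by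
    have key : A * ((2 * (L : ℚ) + 2) * (2 * L + 3) * (2 * L + 4)) = B₀ * (((L : ℚ) + 1) * (L + 2) * (L + 3)) := by
      linear_combination ((2 * (L : ℚ) + 3) * (2 * L + 4)) * c1 + (((L : ℚ) + 1) * (2 * L + 4)) * c2
        + (((L : ℚ) + 1) * (L + 2)) * c3
    have h : (A * (4 * (2 * (L : ℚ) + 3))) * (((L : ℚ) + 1) * (L + 2)) = (B₀ * ((L : ℚ) + 3)) * (((L : ℚ) + 1) * (L + 2)) := by
      linear_combination key
    exact mul_right_cancel₀ (by positivity) h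
  -- 2 B₀ ≤ B₁ ; B₂ = 2 B₁ ; (7/4) B₂ ≤ B₃ (indeed (2L+7)/(L+4) ≥ 7/4 ⟺ L ≥ 0)
  have iB1 : 2 * B₀ ≤ B₁ := by
    have h : (B₁ - 2 * B₀) * ((L : ℚ) + 2) = B₀ := by linear_combination (-1) * d1
    have h0 : 0 ≤ (B₁ - 2 * B₀) * ((L : ℚ) + 2) := by rw [h]; exact hB0.le
    have := nonneg_of_mul_nonneg_left h0 hL2
    linarith
  have eB2 : B₂ = 2 * B₁ := by
    have h : B₂ * ((L : ℚ) + 3) = (2 * B₁) * ((L : ℚ) + 3) := by linear_combination -d2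
    exact mul_right_cancel₀ hL3.ne' h
  have iB3 : (7 / 4) * B₂ ≤ B₃ := by
    have h : (B₃ - (7 / 4) * B₂) * ((L : ℚ) + 4) = (1 / 4) * (L * B₂) := by linear_combination (-1) * d3
    have h0 : 0 ≤ (B₃ - (7 / 4) * B₂) * ((L : ℚ) + 4) := by rw [h]; positivity
    have := nonneg_of_mul_nonneg_left h0 hL4
    linarith
  -- reciprocals
  have jB1 : 1 / B₁ ≤ (1 / 2) * (1 / B₀) := by
    calc 1 / B₁ ≤ 1 / (2 * B₀) := one_div_le_one_div_of_le (by positivity) iB1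
      _ = (1 / 2) * (1 / B₀) := by field_simp
  have jB2 : 1 / B₂ = (1 / 2) * (1 / B₁) := by rw [eB2]; ring
  have jB3 : 1 / B₃ ≤ (4 / 7) * (1 / B₂) := by
    calc 1 / B₃ ≤ 1 / ((7 / 4) * B₂) := one_div_le_one_div_of_le (by positivity) iB3
      _ = (4 / 7) * (1 / B₂) := by field_simp
  -- the exact last factor: x₃ = (L+4)/(2L+7) — used through B₃ = (2L+7)/(L+4)·B₂ ⇒ 1/B₃ = (L+4)/(2L+7)·(1/B₂)
  have jB3' : 1 / B₃ = (((L : ℚ) + 4) / (2 * L + 7)) * (1 / B₂) := by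
    rw [div_mul_div_comm, mul_one, div_eq_div_iff hB3.ne' (by positivity)]; linarith [d3]
  have hu : 0 < 1 / B₀ := by positivity
  have hAu : A * (1 / B₀) ≤ ((L : ℚ) + 3) / (4 * (2 * (L : ℚ) + 3)) := by
    rw [← div_eq_mul_one_div, div_le_div_iff₀ hB0 (by positivity)]; linarith [iA]
  -- assemble
  have hbr : 1 / B₀ + 3 / B₁ + 3 / B₂ + 1 / B₃
      ≤ (1 + 3 / 2 + 3 / 4 + (1 / 4) * (((L : ℚ) + 4) / (2 * L + 7))) * (1 / B₀) := by
    rw [show (3 : ℚ) / B₁ = 3 * (1 / B₁) by ring, show (3 : ℚ) / B₂ = 3 * (1 / B₂) by ring, jB3', jB2]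
    have hx : 0 ≤ ((L : ℚ) + 4) / (2 * L + 7) := by positivity
    have h3 : (1 / 2) * (1 / B₁) ≤ (1 / 2) * ((1 / 2) * (1 / B₀)) := mul_le_mul_of_nonneg_left jB1 (by norm_num)
    nlinarith [mul_le_mul_of_nonneg_left h3 hx, jB1]
  have hbr2 : (1 + 3 / 2 + 3 / 4 + (1 / 4) * (((L : ℚ) + 4) / (2 * L + 7))) * (1 / B₀)
      ≤ (1 + 3 / 2 + 3 / 4 + (1 / 4) * (((L : ℚ) + 4) / (2 * L + 7))) * (1 / B₀) := le_refl _
  have hfinal : A * ((1 + 3 / 2 + 3 / 4 + (1 / 4) * (((L : ℚ) + 4) / (2 * L + 7))) * (1 / B₀))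
      ≤ (((L : ℚ) + 3) * (27 * (L : ℚ) + 95)) / (16 * (2 * (L : ℚ) + 3) * (2 * (L : ℚ) + 7)) := by
    have e : (((L : ℚ) + 3) * (27 * (L : ℚ) + 95)) / (16 * (2 * (L : ℚ) + 3) * (2 * (L : ℚ) + 7))
        = (((L : ℚ) + 3) / (4 * (2 * (L : ℚ) + 3))) * (1 + 3 / 2 + 3 / 4 + (1 / 4) * (((L : ℚ) + 4) / (2 * L + 7))) := by
      field_simp
      ring
    rw [e]
    have hb0 : (0 : ℚ) ≤ 1 + 3 / 2 + 3 / 4 + (1 / 4) * (((L : ℚ) + 4) / (2 * L + 7)) := by positivity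
    calc A * ((1 + 3 / 2 + 3 / 4 + (1 / 4) * (((L : ℚ) + 4) / (2 * L + 7))) * (1 / B₀))
        = (A * (1 / B₀)) * (1 + 3 / 2 + 3 / 4 + (1 / 4) * (((L : ℚ) + 4) / (2 * L + 7))) := by ring
      _ ≤ (((L : ℚ) + 3) / (4 * (2 * (L : ℚ) + 3))) * (1 + 3 / 2 + 3 / 4 + (1 / 4) * (((L : ℚ) + 4) / (2 * L + 7))) :=
          mul_le_mul_of_nonneg_right hAu hb0
  calc A * (1 / B₀ + 3 / B₁ + 3 / B₂ + 1 / B₃)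
      ≤ A * ((1 + 3 / 2 + 3 / 4 + (1 / 4) * (((L : ℚ) + 4) / (2 * L + 7))) * (1 / B₀)) :=
        mul_le_mul_of_nonneg_left hbr hA.le
    _ ≤ _ := hfinal

/-- **`T'(3, k) ≤ 9/10` for every family** (`k = L + 1`): `Σ_i firstTerm L i ≤ firstTerm L 0/(1 − r(L))`, and
`(L+3)(27L+95)/(16(2L+3)(2L+7)) · (L+2)(2L+8)/(L²+7L+16) ≤ 9/10` (`36L⁴ + 152L³ + 1260L² + 4888L + 2784 ≥ 0`). -/
theorem sliceTail_first_three_le (L : ℕ) : sliceTail L (L + 1) 3 ≤ 9 / 10 := by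
  rw [sliceTail_first_eq]
  have h0 := firstTerm_nonneg L 0
  have hr0 := firstRatio_nonneg L
  have hr1 : firstRatio L < 1 := (firstRatio_lt_half L).trans (by norm_num)
  have hsum : ∑ i ∈ range (L + 1), firstTerm L i ≤ firstTerm L 0 * (1 / (1 - firstRatio L)) := by
    calc ∑ i ∈ range (L + 1), firstTerm L i ≤ ∑ i ∈ range (L + 1), firstTerm L 0 * firstRatio L ^ i := by
          apply Finset.sum_le_sum
          intro i hi
          rw [Finset.mem_range] at hi
          exact firstTerm_le_geom L i (by omega)
      _ = firstTerm L 0 * ∑ i ∈ range (L + 1), firstRatio L ^ i := by rw [Finset.mul_sum]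
      _ ≤ firstTerm L 0 * (1 / (1 - firstRatio L)) :=
          mul_le_mul_of_nonneg_left (sum_geom_le_inv (firstRatio L) hr0 hr1 (L + 1)) h0
  have hz := firstTerm_zero_le L
  have hL : (0 : ℚ) ≤ L := by positivity
  have hinv : 0 ≤ 1 / (1 - firstRatio L) := by
    apply div_nonneg (by norm_num); linarith
  -- 1/(1 − r) = (L+2)(2L+8)/(L²+7L+16)
  have hinv_eq : 1 / (1 - firstRatio L) = (((L : ℚ) + 2) * (2 * L + 8)) / ((L : ℚ) ^ 2 + 7 * L + 16) := by
    have h1 : 1 - firstRatio L = ((L : ℚ) ^ 2 + 7 * L + 16) / (((L : ℚ) + 2) * (2 * L + 8)) := by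
      unfold firstRatio
      rw [eq_div_iff (by positivity), sub_mul, div_mul_cancel₀ _ (by positivity)]
      ring
    rw [h1, one_div_div]
  have hfinal : (((L : ℚ) + 3) * (27 * (L : ℚ) + 95)) / (16 * (2 * (L : ℚ) + 3) * (2 * (L : ℚ) + 7))
      * ((((L : ℚ) + 2) * (2 * L + 8)) / ((L : ℚ) ^ 2 + 7 * L + 16)) ≤ 9 / 10 := by
    rw [div_mul_div_comm, div_le_div_iff₀ (by positivity) (by positivity)]
    have hpoly : (0 : ℚ) ≤ 36 * (L : ℚ) ^ 4 + 152 * (L : ℚ) ^ 3 + 1260 * (L : ℚ) ^ 2 + 4888 * L + 2784 := by positivity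
    nlinarith [hpoly]
  calc ∑ i ∈ range (L + 1), firstTerm L i ≤ firstTerm L 0 * (1 / (1 - firstRatio L)) := hsum
    _ ≤ (((L : ℚ) + 3) * (27 * (L : ℚ) + 95)) / (16 * (2 * (L : ℚ) + 3) * (2 * (L : ℚ) + 7)) * (1 / (1 - firstRatio L)) :=
        mul_le_mul_of_nonneg_right hz hinv
    _ = (((L : ℚ) + 3) * (27 * (L : ℚ) + 95)) / (16 * (2 * (L : ℚ) + 3) * (2 * (L : ℚ) + 7))
        * ((((L : ℚ) + 2) * (2 * L + 8)) / ((L : ℚ) ^ 2 + 7 * L + 16)) := by rw [hinv_eq]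
    _ ≤ 9 / 10 := hfinal

/-- **`T'(m) ≤ T'(3)`** for `3 ≤ m ≤ L(L+1)` (the descent of `sliceTail_succ_le_self`). -/
lemma sliceTail_first_le_three (L m : ℕ) (h3 : 3 ≤ m) (hm : m ≤ L * (L + 1)) :
    sliceTail L (L + 1) m ≤ sliceTail L (L + 1) 3 := by
  obtain ⟨d, rfl⟩ : ∃ d, m = 3 + d := ⟨m - 3, by omega⟩
  induction d with
  | zero => simp
  | succ d ih =>
    calc sliceTail L (L + 1) (3 + (d + 1)) = sliceTail L (L + 1) (3 + d + 1) := by rw [Nat.add_assoc]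
      _ ≤ sliceTail L (L + 1) (3 + d) := sliceTail_succ_le_self L (L + 1) (3 + d) (by nlinarith)
      _ ≤ sliceTail L (L + 1) 3 := ih (by omega) (by omega)

/-- **THE FIRST UNTRUNCATED SLICE ON THE BOTTOM REGIME, EVERY FAMILY**: `k = L + 1`, `u = L`, `q = m + L`, `3 ≤ m ≤ L(L+1)`
⇒ `Φ(q+k, q) ≤ R̂(q, k, m)`. -/
theorem first_untrunc_bottom (L m : ℕ) (h3 : 3 ≤ m) (hm : m ≤ L * (L + 1)) :
    phiK (m + L + (L + 1)) (m + L) ≤ rhat (m + L) (L + 1) m := by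
  apply phiK_le_rhat_of_sliceTail_le_one L (L + 1) m (by omega) (by nlinarith)
  calc sliceTail L (L + 1) m ≤ sliceTail L (L + 1) 3 := sliceTail_first_le_three L m h3 hm
    _ ≤ 9 / 10 := sliceTail_first_three_le L
    _ ≤ 1 := by norm_num

/-- **The slice `u = k − 1` in the cell spelling**: `1 ≤ k`, `k + 2 ≤ q`, `q + 1 ≤ k²` ⇒ `Φ(q+k, q) ≤ R̂(q, k, q − (k−1))`. -/
theorem first_untrunc_slice (k q : ℕ) (hk : 1 ≤ k) (hq : k + 2 ≤ q) (hq' : q + 1 ≤ k * k) :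
    phiK (q + k) q ≤ rhat q k (q - (k - 1)) := by
  obtain ⟨L, rfl⟩ : ∃ L, k = L + 1 := ⟨k - 1, by omega⟩
  obtain ⟨m, rfl⟩ : ∃ m, q = m + L := ⟨q - L, by omega⟩
  rw [show m + L - (L + 1 - 1) = m by omega]
  exact first_untrunc_bottom L m (by omega) (by nlinarith)

/-- **The slice `u = k − 1` on every cell `k − 1 ≤ q ≤ k² − 1` except possibly `q = k + 1`** (`k ≥ 2`): `q = k − 1` is the
identity cell (`rhat_zero_eq`), `q = k` is `rhatCell_one`, and `q ≥ k + 2` is `first_untrunc_slice`. -/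
theorem first_untrunc_slice_all (k q : ℕ) (hk : 2 ≤ k) (hq : k - 1 ≤ q) (hq' : q + 1 ≤ k * k) (hne : q ≠ k + 1) :
    phiK (q + k) q ≤ rhat q k (q - (k - 1)) := by
  rcases Nat.lt_or_ge q (k + 2) with h | h
  · rcases Nat.lt_or_ge q k with h0 | h1
    · have : q = k - 1 := by omega
      subst this
      rw [Nat.sub_self, rhat_zero_eq _ _ (by omega)]
    · have : q = k := by omega
      subst this
      rw [show q - (q - 1) = 1 by omega]
      exact rhatCell_one q q (by omega) hk
  · exact first_untrunc_slice k q (by omega) h hq'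

end PercRepro
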